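import Summits.BirchSwinnertonDyer.BirchSwinnertonDyer.Theorems.ClassRecordThreeEulerHalvesAtThreeCartanCorrespondenceCut
import HarnessLib

/-!
# Crux 19109 `EulerHalvesAtThree` ∕ 23422 line `cartan` v9, stub (F2b♭) — the correspondence cut is TIGHT: modulo COR the orientation SIGN is EQUIVALENT to the
# `V`-minimal one-place law, and modulo S3♭ the `V`-minimal law is equivalent to the class-minimal law NUM (all PROVED; one new named `Prop`, NUM_V)

Seat `bsd-idea-10` g12 (planner-bsd-idea-10-g12-0, D-0145 ideator; `--supports stmt-BirchSwinnertonDyer-19109 --as helper`; companion of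
`…CartanCorrespondenceCut` (p686517) and of the unregistered workfile `Cruxes/EulerHalvesAtThree/Lines/cartan_corr.lean`).

WHAT IS PROVED HERE (sorry-free; NUM = `CartanOnePlaceDegreeLawAtThree`, NUM_V = `CartanOnePlaceDegreeLawVMinAtThree` (§1), COR ∕ U♯ ∕ SIGN ∕ S3♭ as in the Cut):
* `onePlaceLawVMin_of_correspondence` : COR → U♯ → SIGN → NUM_V (the Cut's derivation, without the class-minimal bookkeeping);
* `sign_of_onePlaceLawVMin` : NUM_V → SIGN — so, GIVEN COR ∧ U♯, the residual input SIGN («`3 ∣ a`») is EQUIVALENT to NUM_V: it is not an over-strong auxiliary;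
* `onePlaceLaw_of_onePlaceLawVMin` : S3♭ → NUM_V → NUM and `onePlaceLawVMin_of_onePlaceLaw` : S3♭ → NUM → NUM_V (class-minimal data exist on any Cartan-level curve that
  carries a datum for `V`, `exists_isMinimalFor_of_datum`, by well-ordering — no (F3) needed) — so modulo S3♭ the two laws are equivalent;
* hence (`cartanHomLatticeDictionaryAtThreeVal_of_onePlaceLawVMin`) S-K1′ → supply → S3♭ → NUM_V → (F2b♭) BY NAME.
Net: given the «free» inputs (S-K1′, supply, S3♭, COR, U♯) the sets {(F2b♭)}, {NUM}, {NUM_V}, {SIGN} are pairwise equivalent — the geometric residual of the Cartan road's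
dictionary stub is ONE statement in four typings. HONEST FRAMING: none of NUM, NUM_V, SIGN, COR, (F2b♭) is proved; no summit statement, no route item and no registered
stub is proved; BSD is proved for no curve. References: [cite: KohenPacetti2016, Rem. 3.8 (arXiv:1403.7801v3 p. 15)] [cite: CaiShuTian2014, Prop. 3.8 p. 21].
-/

set_option linter.dupNamespace false
set_option autoImplicit false

noncomputable section

open scoped Classical MatrixGroups NumberField UpperHalfPlane

namespace Summit.BirchSwinnertonDyer.BirchSwinnertonDyer.Theorems.CartanCorrespondence

open WeierstrassCurve IsDedekindDomain NumberField Field Literature.NumberTheory.EllipticCurves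
  Literature.NumberTheory.EllipticCurves.ModularForms
  Literature.NumberTheory.EllipticCurves.Rank1Residual Literature.NumberTheory.Automorphic
  Summit.BirchSwinnertonDyer.Rank1Residual Summit.BirchSwinnertonDyer.BirchSwinnertonDyer.Theorems
  Summit.BirchSwinnertonDyer.BirchSwinnertonDyer.Theorems.CartanDegree
  Summit.BirchSwinnertonDyer.BirchSwinnertonDyer.Theorems.CartanTorusCubeCut

/-! ## §1 The `V`-minimal one-place law (definition only) -/

/-- **NUM_V — THE ONE-PLACE DEGREE LAW FOR `V`-MINIMAL DEGREES**: at a Cartan place `q` of `V` (X11b@3, `Surj V 3`) the least degree of a Cartan-level datum targeting `V`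
ITSELF at level `(D, Mq²; C∖q)` has exactly one more `3` than the one at level `(D, M; C)` (`ord₃ m_s(V) = ord₃ m_C(V) + 1`). Binders = those of COR without the torus.
Equivalent to NUM modulo S3♭ and to SIGN modulo COR ∧ U♯ (this file). NOT IN PRINT. Why it might fail: as (F2b♭) ∕ NUM. [cite: KohenPacetti2016, Rem. 3.8] -/
@[conjecture]
def CartanOnePlaceDegreeLawVMinAtThree : Prop :=
    ∀ (V : WeierstrassCurve ℚ) [V.IsElliptic] [V.IsGloballyMinimal], ClassX11b V 3 → Surj V 3 →
      ∀ (N D M : ℕ) (C : Finset ℕ) (q : ℕ) [Fact q.Prime]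
        (X : CartanLevelCurveData D M C) (QV : CartanParametrizationData X V)
        (X' : CartanLevelCurveData D (M * q ^ 2) (C.erase q)) (QV' : CartanParametrizationData X' V),
        V.conductorNorm ℤ = N → D * M * ∏ p ∈ C, p ^ 2 = N → q ∈ C → q ≠ 3 → ¬ q ^ 3 ∣ N →
        3 ∣ (V.baseChange ℚ_[q]).localTamagawaNumber ℤ_[q] →
        (∀ Q'' : CartanParametrizationData X V, QV.deg ≤ Q''.deg) → (∀ Q'' : CartanParametrizationData X' V, QV'.deg ≤ Q''.deg) →
        padicValNat 3 QV'.deg = padicValNat 3 QV.deg + 1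

/-! ## §2 PROVED: NUM_V from COR ∧ U♯ ∧ SIGN, and SIGN back from NUM_V -/

/-- PROVED: COR → U♯ → SIGN → NUM_V. [folklore] -/
theorem onePlaceLawVMin_of_correspondence (hC : CartanCorrespondenceDegreeIdentityAtThree) (hU : CubicTorusPairSumAtThree)
    (hsgn : CartanCorrespondenceSignAtThree) : CartanOnePlaceDegreeLawVMinAtThree := by
  intro V _ _ hX hsurj N D M C q _ X QV X' QV' hVN hDMN hq hq3 hq3N hcq hmin hmin'
  haveI : Fact (Nat.Prime 3) := ⟨Nat.prime_three⟩
  have hqp : q.Prime := Fact.out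
  obtain ⟨η, hη, hT0, hTv⟩ := hU q hq3
  obtain ⟨a, b, h1, h2⟩ := hC V hX hsurj N D M C q X QV X' QV' η hVN hDMN hq hq3 hq3N hcq hη hmin hmin'
  have h3a : 3 ∣ a := hsgn V hX hsurj N D M C q X QV X' QV' η hVN hDMN hq hq3 hq3N hcq hη hmin hmin' a b h1 h2 hT0
  obtain ⟨hT, h1', h2'⟩ := natIdentities_of_intIdentities hqp.two_le QV'.deg_pos h1 h2
  have hS : (torusPairSum q η).toNat ≠ 0 := by
    intro h; apply hT0; have := Int.toNat_of_nonneg hT; omega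
  have hc : (q - 1) ^ 2 ≠ 0 := pow_ne_zero 2 (by have := hqp.two_le; omega)
  have hv : padicValNat 3 (torusPairSum q η).toNat = 1 + padicValNat 3 ((q - 1) ^ 2) := by
    have e : padicValInt 3 (torusPairSum q η) = padicValNat 3 (torusPairSum q η).toNat := by
      conv_lhs => rw [← Int.toNat_of_nonneg hT]
      exact padicValInt.of_nat
    rw [padicValNat.pow, ← e, hTv]
  exact padicValNat_law_of_identities_of_dvd hS hc (ne_of_gt QV'.deg_pos) (ne_of_gt QV.deg_pos) h1' h2' hv h3a

/-- PROVED (pure arithmetic): `a²·c·mC = S·mS`, `b²·c·mS = S·mC`, `S ≠ 0` and `ord₃ mS = ord₃ mC + 1` force `ord₃ a = ord₃ b + 1`, so `3 ∣ a`. [folklore] -/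
theorem three_dvd_of_identities_of_law {a b c mS mC S : ℕ} (hS : S ≠ 0) (hc : c ≠ 0) (hmS : mS ≠ 0) (hmC : mC ≠ 0)
    (h1 : a ^ 2 * c * mC = S * mS) (h2 : b ^ 2 * c * mS = S * mC) (hlaw : padicValNat 3 mS = padicValNat 3 mC + 1) : 3 ∣ a := by
  haveI : Fact (Nat.Prime 3) := ⟨Nat.prime_three⟩
  have ha : a ≠ 0 := by
    rintro rfl; simp at h1; rcases h1 with h | h <;> contradiction
  have hb : b ≠ 0 := by
    rintro rfl; simp at h2; rcases h2 with h | h <;> contradiction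
  have e1 := congrArg (padicValNat 3) h1
  have e2 := congrArg (padicValNat 3) h2
  rw [padicValNat.mul (mul_ne_zero (pow_ne_zero 2 ha) hc) hmC, padicValNat.mul (pow_ne_zero 2 ha) hc, padicValNat.pow,
    padicValNat.mul hS hmS, hlaw] at e1
  rw [padicValNat.mul (mul_ne_zero (pow_ne_zero 2 hb) hc) hmS, padicValNat.mul (pow_ne_zero 2 hb) hc, padicValNat.pow,
    padicValNat.mul hS hmC, hlaw] at e2
  have h1a : 1 ≤ padicValNat 3 a := by omega
  by_contra hnd
  have := padicValNat.eq_zero_of_not_dvd hnd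
  omega

/-- PROVED — **SIGN ⟸ NUM_V**: the orientation follows from the `V`-minimal law through the two correspondence identities (which SIGN carries as hypotheses).
With `onePlaceLawVMin_of_correspondence`: modulo COR ∧ U♯, SIGN ⟺ NUM_V. [folklore] -/
theorem sign_of_onePlaceLawVMin (hN : CartanOnePlaceDegreeLawVMinAtThree) : CartanCorrespondenceSignAtThree := by
  intro V _ _ hX hsurj N D M C q _ X QV X' QV' η hVN hDMN hq hq3 hq3N hcq hη hmin hmin' a b h1 h2 hT0
  haveI : Fact (Nat.Prime 3) := ⟨Nat.prime_three⟩
  have hqp : q.Prime := Fact.out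
  have hlaw := hN V hX hsurj N D M C q X QV X' QV' hVN hDMN hq hq3 hq3N hcq hmin hmin'
  obtain ⟨hT, h1', h2'⟩ := natIdentities_of_intIdentities hqp.two_le QV'.deg_pos h1 h2
  have hS : (torusPairSum q η).toNat ≠ 0 := by
    intro h; apply hT0; have := Int.toNat_of_nonneg hT; omega
  have hc : (q - 1) ^ 2 ≠ 0 := pow_ne_zero 2 (by have := hqp.two_le; omega)
  exact three_dvd_of_identities_of_law hS hc (ne_of_gt QV'.deg_pos) (ne_of_gt QV.deg_pos) h1' h2' hlaw

/-! ## §3 PROVED: NUM ⟺ NUM_V modulo S3♭ (class-minimal data exist wherever a datum exists, by well-ordering) -/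

/-- PROVED: a Cartan-level curve carrying SOME datum whose target is isogenous to `V` carries a class-minimal datum for `V` (least degree over the class, by
well-ordering of `ℕ`; the pattern of `…CartanDegreeOfStubs.exists_isMinimalFor_of_F3` without (F3)). [folklore] -/
theorem exists_isMinimalFor_of_datum {D M : ℕ} {C : Finset ℕ} (X : CartanLevelCurveData D M C)
    (V : WeierstrassCurve ℚ) [V.IsElliptic] {W : WeierstrassCurve ℚ} [W.IsElliptic] (Q₁ : CartanParametrizationData X W)
    (hiso : V.IsIsogenous W) :
    ∃ (W'' : WeierstrassCurve ℚ) (_ : W''.IsElliptic) (Q : CartanParametrizationData X W''), Q.IsMinimalFor V := by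
  let P : ℕ → Prop := fun d => ∃ (W'' : WeierstrassCurve ℚ) (_ : W''.IsElliptic)
      (Q : CartanParametrizationData X W''), V.IsIsogenous W'' ∧ Q.deg = d
  have hP : ∃ d, P d := ⟨Q₁.deg, W, inferInstance, Q₁, hiso, rfl⟩
  obtain ⟨W'', hW'', Q, hisoQ, hdeg⟩ := Nat.find_spec hP
  refine ⟨W'', hW'', Q, hisoQ, ?_⟩
  intro W₃ _ Q₃ hiso₃
  have hle : Nat.find hP ≤ Q₃.deg := Nat.find_min' hP ⟨W₃, inferInstance, Q₃, hiso₃, rfl⟩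
  rw [hdeg]; exact hle

/-- PROVED: a `V`-minimal datum and a class-minimal datum on the same curve have degrees with the same `ord₃`, given S3♭. [folklore] -/
theorem padicValNat_deg_eq_of_vMinimal (hS3 : CartanMinimalDegreeValAtThree)
    (V : WeierstrassCurve ℚ) [V.IsElliptic] [V.IsGloballyMinimal] (hX : ClassX11b V 3) (hsurj : Surj V 3)
    {D M : ℕ} {C : Finset ℕ} (X : CartanLevelCurveData D M C) {W₁ : WeierstrassCurve ℚ} [W₁.IsElliptic]
    (Q : CartanParametrizationData X W₁) (hQ : Q.IsMinimalFor V)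
    (QV : CartanParametrizationData X V) (hmin : ∀ Q'' : CartanParametrizationData X V, QV.deg ≤ Q''.deg) :
    padicValNat 3 QV.deg = padicValNat 3 Q.deg := by
  obtain ⟨QV₀, hmin₀, hv₀⟩ := hS3 V hX hsurj D M C X W₁ Q hQ
  have h₁ : QV.deg ≤ QV₀.deg := hmin QV₀
  have h₂ : QV₀.deg ≤ QV.deg := hmin₀ QV
  rw [← hv₀, le_antisymm h₁ h₂]

/-- PROVED — **NUM ⟸ S3♭ ∧ NUM_V**. [folklore] -/
theorem onePlaceLaw_of_onePlaceLawVMin (hS3 : CartanMinimalDegreeValAtThree) (hN : CartanOnePlaceDegreeLawVMinAtThree) :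
    CartanOnePlaceDegreeLawAtThree := by
  intro V _ _ hX hsurj N D M C q _ X W₁ _ Q X' W₂ _ Q' hVN hDMN hq hq3 hq3N hcq hQ hQ'
  obtain ⟨QV, hmin, hvQV⟩ := hS3 V hX hsurj D M C X W₁ Q hQ
  obtain ⟨QV', hmin', hvQV'⟩ := hS3 V hX hsurj D (M * q ^ 2) (C.erase q) X' W₂ Q' hQ'
  rw [← hvQV, ← hvQV']
  exact hN V hX hsurj N D M C q X QV X' QV' hVN hDMN hq hq3 hq3N hcq hmin hmin'

/-- PROVED — **NUM_V ⟸ S3♭ ∧ NUM** (class-minimal data exist by `exists_isMinimalFor_of_datum`; their `ord₃` agree with the `V`-minimal ones by S3♭). [folklore] -/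
theorem onePlaceLawVMin_of_onePlaceLaw (hS3 : CartanMinimalDegreeValAtThree) (hN : CartanOnePlaceDegreeLawAtThree) :
    CartanOnePlaceDegreeLawVMinAtThree := by
  intro V _ _ hX hsurj N D M C q _ X QV X' QV' hVN hDMN hq hq3 hq3N hcq hmin hmin'
  obtain ⟨W₁, hW₁, Q, hQ⟩ := exists_isMinimalFor_of_datum X V QV V.isIsogenous_self
  obtain ⟨W₂, hW₂, Q', hQ'⟩ := exists_isMinimalFor_of_datum X' V QV' V.isIsogenous_self
  have hlaw := hN V hX hsurj N D M C q X W₁ Q X' W₂ Q' hVN hDMN hq hq3 hq3N hcq hQ hQ'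
  rw [padicValNat_deg_eq_of_vMinimal hS3 V hX hsurj X Q hQ QV hmin, padicValNat_deg_eq_of_vMinimal hS3 V hX hsurj X' Q' hQ' QV' hmin']
  exact hlaw

/-! ## §4 PROVED: (F2b♭) BY NAME from S-K1′, the supply, S3♭ and the `V`-minimal law -/

/-- PROVED — S-K1′ → supply → S3♭ → NUM_V → `CartanDegree.CartanHomLatticeDictionaryAtThreeVal`. [folklore] -/
theorem cartanHomLatticeDictionaryAtThreeVal_of_onePlaceLawVMin (h2a : CubicTorusPeriodRatioAtThree) (hL : CartanTorusLatticeSupply)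
    (hS3 : CartanMinimalDegreeValAtThree) (hN : CartanOnePlaceDegreeLawVMinAtThree) : CartanHomLatticeDictionaryAtThreeVal :=
  dictionaryVal_of_onePlaceLaw h2a hL (onePlaceLaw_of_onePlaceLawVMin hS3 hN)

end Summit.BirchSwinnertonDyer.BirchSwinnertonDyer.Theorems.CartanCorrespondence

end
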